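import Mathlib.Probability.BrownianMotion.Basic
import Mathlib.Probability.Independence.Basic
import HarnessLib

/-!
# Kolmogorov's zero-one law for Brownian increments (shift form)

Topic: Probability / stochastic processes. For a pre-Brownian motion `B` (Mathlib
`ProbabilityTheory.IsPreBrownianReal`: Gaussian finite-dimensional laws of Brownian motion) with
measurable marginals on a probability space `(Ω, P)`, an event `E` which for every `n : ℕ`
coincides almost surely with an event of the *increment process after time `n`*,
`{ω | (u ↦ B (n + u) ω - B n ω) ∈ Sₙ}` with `Sₙ` a measurable set of paths (product σ-algebra on
`ℝ≥0 → ℝ`), has probability `0` or `1`: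
`ProbabilityTheory.IsPreBrownianReal.measure_zero_or_one_of_shift` (**proved**).

This is the form of Kolmogorov's zero-one law used for tail events *at infinity* of functionals
of a Brownian path (e.g. transience of the SLE trace, `SLETransienceZeroOne.lean`): the tail
σ-field `⋂ₙ σ(B(n + u) - B(n), u ≥ 0)` is trivial.

Proof: by the weak Markov property (Mathlib `IsPreBrownianReal.indepFun_shift`: the increment
process after `n` is independent of `(B t)_{t ≤ n}`), `E` is independent of every event of the
natural filtration at integer times; these events form a π-system generating `σ(B)`, which
contains a version of `E`; so `E` is independent of itself (Mathlib `IndepSets.indep`, the π-λ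
theorem) and `P E = (P E)²`.

## Mathlib

We USE `ProbabilityTheory.IsPreBrownianReal.indepFun_shift`, `ProbabilityTheory.IndepSets.indep`,
`IndepFun_iff_Indep`, `Indep_iff`, `IndepSets_iff`, `MeasurableSpace.generateFrom_iUnion_measurableSet`,
`isPiSystem_iUnion_of_monotone`, `ENNReal.mul_eq_left`. Mathlib has Kolmogorov's 0-1 law for an
independent *sequence* of σ-algebras (`ProbabilityTheory.measure_zero_or_one_of_measurableSet_limsup_atTop`)
but not this shift form for processes with independent increments; Blumenthal's 0-1 law (tail at
`0⁺`) is NOT here.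

## References

* O. Kallenberg, *Foundations of Modern Probability*, 2nd ed., Springer (2002): Thm. 3.13
  (Kolmogorov's zero-one law), Thm. 13.4 (Brownian motion has independent increments).
* D. Revuz, M. Yor, *Continuous Martingales and Brownian Motion*, 3rd ed., Springer (1999),
  Ch. III §2 (the simple Markov property).
-/

noncomputable section

open Set Filter MeasureTheory ProbabilityTheory
open scoped NNReal ENNReal

namespace Literature.Probability.Process

/-! ### Kolmogorov's zero-one law for shift-tail events of a pre-Brownian motion -/

section ZeroOne

variable {Ω : Type*} {mΩ : MeasurableSpace Ω} {P : Measure Ω} {B : ℝ≥0 → Ω → ℝ}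

/-- **Kolmogorov's zero-one law for Brownian increments, shift form.** Let `B` be a pre-Brownian
motion with measurable marginals and `E` an event which, for every `n : ℕ`, coincides a.s. with
an event of the increment process after time `n`, `{ω | (u ↦ B (n + u) ω - B n ω) ∈ S n}` with
`S n` a measurable set of paths. Then `P E ∈ {0, 1}`. Proof: by the weak Markov property
(Mathlib `IsPreBrownianReal.indepFun_shift`) `E` is independent of `σ(B t, t ≤ n)` for every `n`,
hence (π-λ) of `σ(B) ∋ E`, so `P E = (P E)²`. A dot-notation extension of Mathlib's
`ProbabilityTheory.IsPreBrownianReal`, deliberately declared in Mathlib's namespace `ProbabilityTheory`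
(as the extensions of `BrownianMotion.lean`). Kallenberg, *Foundations of Modern Probability*
(2002), Thm. 3.13 (Kolmogorov's zero-one law) with Thm. 13.4 (independent increments);
Revuz–Yor (1999), Ch. III, proof of Thm. (2.15) ff. [cite: Kallenberg2002, Thm 3.13] -/
theorem _root_.ProbabilityTheory.IsPreBrownianReal.measure_zero_or_one_of_shift
    (hB : IsPreBrownianReal B P)
    (hm : ∀ t, Measurable (B t)) {E : Set Ω} {S : ℕ → Set (ℝ≥0 → ℝ)}
    (hS : ∀ n, MeasurableSet (S n))
    (hE : ∀ n : ℕ, E =ᵐ[P] (fun ω u ↦ B ((n : ℝ≥0) + u) ω - B (n : ℝ≥0) ω) ⁻¹' S n) :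
    P E = 0 ∨ P E = 1 := by
  haveI : IsProbabilityMeasure P := hB.isGaussianProcess.isProbabilityMeasure
  -- the natural filtration at integer times and the increment maps
  set r : ∀ k : ℕ, Ω → (Iic (k : ℝ≥0) → ℝ) := fun k ω t ↦ B t ω with hr
  set F : ℕ → MeasurableSpace Ω := fun k ↦ MeasurableSpace.comap (r k) inferInstance with hF
  set sh : ℕ → Ω → (ℝ≥0 → ℝ) := fun n ω u ↦ B ((n : ℝ≥0) + u) ω - B (n : ℝ≥0) ω with hsh
  have hr_meas : ∀ k, Measurable (r k) := fun k ↦ measurable_pi_lambda _ fun t ↦ hm _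
  have hsh_meas : ∀ n, Measurable (sh n) := fun n ↦
    measurable_pi_lambda _ fun u ↦ (hm _).sub (hm _)
  have hFle : ∀ k, F k ≤ mΩ := fun k ↦ (hr_meas k).comap_le
  have hFmono : Monotone F := by
    intro k n hkn
    have hkn' : (k : ℝ≥0) ≤ n := by exact_mod_cast hkn
    -- `r k` factors through `r n`
    set π : (Iic (n : ℝ≥0) → ℝ) → (Iic (k : ℝ≥0) → ℝ) := fun f t ↦ f ⟨t, t.2.trans hkn'⟩ with hπ
    have hπm : Measurable π := measurable_pi_lambda _ fun t ↦ measurable_pi_apply _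
    have hcomp : r k = π ∘ r n := rfl
    change MeasurableSpace.comap (r k) inferInstance ≤ MeasurableSpace.comap (r n) inferInstance
    rw [hcomp, ← MeasurableSpace.comap_comp]
    exact MeasurableSpace.comap_mono hπm.comap_le
  -- independence of the increments after `n` from `F n`
  have hind : ∀ n, Indep (MeasurableSpace.comap (sh n) inferInstance) (F n) P := fun n ↦
    (IndepFun_iff_Indep _ _ _).1 (hB.indepFun_shift (n : ℝ≥0))
  -- `E` is independent of every `F k`-event
  have hEmeas : ∀ n, P E = P (sh n ⁻¹' S n) := fun n ↦ measure_congr (hE n)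
  have hprod : ∀ k (C : Set Ω), MeasurableSet[F k] C → P (E ∩ C) = P E * P C := by
    intro k C hC
    have hC' : MeasurableSet[F k] C := hC
    have h1 : P (E ∩ C) = P (sh k ⁻¹' S k ∩ C) := measure_congr ((hE k).inter EventuallyEq.rfl)
    have h2 : MeasurableSet[MeasurableSpace.comap (sh k) inferInstance] (sh k ⁻¹' S k) :=
      ⟨S k, hS k, rfl⟩
    rw [h1, (Indep_iff _ _ _).1 (hind k) _ _ h2 hC', ← hEmeas k]
  -- the π-system `⋃ k, F k` generates `⨆ k, F k`
  set p : Set (Set Ω) := ⋃ k, {C | MeasurableSet[F k] C} with hp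
  have hp_pi : IsPiSystem p :=
    isPiSystem_iUnion_of_monotone (fun k ↦ {C | MeasurableSet[F k] C})
      (fun k ↦ @MeasurableSpace.isPiSystem_measurableSet Ω (F k)) (fun k n hkn C hC ↦ hFmono hkn C hC)
  have hp_gen : MeasurableSpace.generateFrom p = ⨆ k, F k :=
    MeasurableSpace.generateFrom_iUnion_measurableSet F
  -- a version `E'` of `E` measurable with respect to `σ(B)`
  set E' : Set Ω := sh 0 ⁻¹' S 0 with hE'
  have hEE' : E =ᵐ[P] E' := by simpa [hE', hsh] using hE 0
  have hE'meas : MeasurableSet E' := hsh_meas 0 (hS 0)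
  -- `E'` is `⨆ k, F k`-measurable: every marginal `B u` is `F ⌈u⌉`-measurable
  have hcoord : ∀ u : ℝ≥0, Measurable[⨆ k, F k] (B u) := by
    intro u
    obtain ⟨k, hk⟩ := exists_nat_ge u
    have h1 : Measurable[F k] (B u) :=
      (measurable_pi_apply (⟨u, hk⟩ : Iic (k : ℝ≥0))).comp (comap_measurable (r k))
    exact h1.mono (le_iSup F k) le_rfl
  have hsh0 : Measurable[⨆ k, F k] (sh 0) :=
    @measurable_pi_lambda Ω ℝ≥0 (fun _ ↦ ℝ) (⨆ k, F k) _ (sh 0) fun u ↦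
      (hcoord _).sub (hcoord _)
  have hE'tail : MeasurableSet[⨆ k, F k] E' := hsh0 (hS 0)
  -- independence of `σ(E')` and `⨆ k, F k`
  have hindep : Indep (MeasurableSpace.generateFrom {E'}) (⨆ k, F k) P := by
    refine IndepSets.indep (MeasurableSpace.generateFrom_le (by simpa using hE'meas))
      (iSup_le hFle) (IsPiSystem.singleton E') hp_pi rfl hp_gen.symm ?_
    rw [IndepSets_iff]
    rintro t C ht ⟨_, ⟨k, rfl⟩, hC⟩
    rw [mem_singleton_iff] at ht
    subst ht
    rw [measure_congr (hEE'.symm.inter EventuallyEq.rfl), hprod k C hC, measure_congr hEE']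
  have hsq : P E' = P E' * P E' := by
    have := (Indep_iff _ _ _).1 hindep E' E' (MeasurableSpace.measurableSet_generateFrom rfl) hE'tail
    rwa [inter_self] at this
  rw [measure_congr hEE']
  by_cases h0 : P E' = 0
  · exact Or.inl h0
  · exact Or.inr ((ENNReal.mul_eq_left h0 (measure_ne_top P E')).1 hsq.symm)

end ZeroOne

end Literature.Probability.Process
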